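import Summits.QuantumFields.BalabanUV.Beta.FP.RelInvPeriodisedChartMinOp
import Summits.QuantumFields.BalabanUV.Beta.FP.RelInvPeriodisedMinOpRecord

/-!
# `BalabanUV.Beta.FP.RelInvPeriodisedChartMinOpRecord` — road «FP» (binder row D1), ROUTE T row **(T-INV)**, CHART-GENERIC EDITION of
# `RelInvPeriodisedMinOpRecord` §3: **THE `μ`-COLUMNS OF `minOp`, THE `μ`-ROWS OF `minOpL` AND THE FLUCTUATION COVARIANCE `flucCov` OF THE COMB-SLICED
# PERIODISED SYSTEM AT THE PRESENTATION OF RECORD, FOR ANY PERIODISABLE RELATIVE-INVERSE CHART** `(A, 𝕄)` at an in-block root `toSite r` — `±Â` masked by an2's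
# live indicator `axEc (toSite r) Lc` on the field slots (`Â := perF M A`)

HONEST DEPENDENCY (page 1, mandatory): continuum YM on T⁴ ⇐ BetaPertH ∧ nine spine estimates (0/9 proved); BetaPertH ⇐ (D1) ∧ (D4) ∧
CAP+tail; G-an2-4 gates asym, D1 and NE2/3/4.  HONEST FRAMING (cell contract, verbatim): «discharging `BetaPertH` makes Bałaban's UV
stability UNCONDITIONAL — a real constructive-QFT result; it is NOT the continuum limit and NOT the Clay problem.»  ABSOLUTE RULE (cell
charter, verbatim): «No internally-minted statement may enter as a cited fact. Every hypothesis is either kernel-proved in this package or a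
verbatim quotation of a PUBLISHED theorem with page reference. The manuscript(s) under audit are NOT citable for their own disputed steps — they
are the thing under adjudication; programme-internal (2001/route/tribunal) claims are never citable.»

CONTENT (proofs = leaf-05 g26's `RelInvPeriodisedMinOpRecord` §3 VERBATIM, the chart abstracted; the chart-free bookkeeping `comb_presentation` ∕
`comb_mask_eq_axEc_mul` and the generic entry lemmas `minOp_fromRows_apply_inl ∕ minOpL_fromRows_apply_inl ∕ flucCov_fromRows_apply` reused BY NAME).  At the presentation of
record (fields `(s, α) ↦ (s, inl α)`, `τ₁ := combRowsT (toSite r) Lc M` on the field slots, coarse multipliers by any injective `inr`-valued `fμ` with `hcoarse`):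
**`torus_minOp_inl_of_relInv`** (`minOp H₀ [Q₁₀;τ₁] (s, α) (inl a) = axEc s s (inl α) (inl α) · Â (s, inl α) (fμ a)`), **`torus_minOpL_inl_of_relInv`** (`minOpL … (inl a) (s, α)
= −(axEc … · Â (fμ a) (s, inl α))`), the matrix forms `torus_minOp_submatrix_inl_of_relInv ∕ torus_minOpL_submatrix_inl_of_relInv`, **`torus_flucCov_apply_of_relInv`** ∕
`torus_flucCov_eq_of_relInv` (`flucCov … (s,α) (s',α') = axEc s s α α · axEc s' s' α' α' · Â (s, inl α) (s', inl α')`).  Instances: the rooted chart (leaf-05 g26, untouched)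
and chart (III′) (`FP/RelInvPeriodisedComb*`).  [folklore]; no `Prop`, no `def`, nothing cited, 0 sorry; discharges NO binder of row D1; NOT the dictionary's
`hId₁`, NOT (J-a), NOT (T-ID), NOT SDF, NOT D1, NOT BetaPertH, NOT continuum, NOT Clay; 0 estimates.  Unit `b2b-balaban-beta-d1-formalise-leaf-05` (gen 29),
2026-08-22; no existing file touched.
-/

noncomputable section

open scoped BigOperators Matrix

namespace Summit.QuantumFields.BalabanUV.Beta.FP.RelInvPeriodisedChartMinOpRecord

open Matrix
open Literature.Probability.LatticeModels (Torus.proj)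
open Literature.MathematicalPhysics.QuantumFieldTheory.Balaban1983to89
open Literature.MathematicalPhysics.QuantumFieldTheory.Balaban1983to89.Beta
open Literature.MathematicalPhysics.QuantumFieldTheory.Balaban1983to89.Beta.Composition (kkt)
open Literature.MathematicalPhysics.QuantumFieldTheory.Balaban1983to89.Beta.CompositionSingular (effForm flucCov minOp minOpL)
open B6Lemma24Torus (pbox)
open ExpKernelCalculus (MKer shiftK)
open AffineAveraging (Site box toSite)
open OneStepResolventKernel (Fib)
open Summit.QuantumFields.BalabanUV.Beta.TameKernelCalculus (Spr)
open Summit.QuantumFields.BalabanUV.Beta.ChartConjugationRelative (RelInv)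
open Summit.QuantumFields.BalabanUV.Beta.AxialDressingRooted (axEc axEc_inl_inl axEc_inr_inr IsCombBondAt)
open Summit.QuantumFields.BalabanUV.Beta.FP.KernelPeriodisationFib (Idx perF)
open Summit.QuantumFields.BalabanUV.Beta.FP.TorusCombRows (Res combRowsT)
open Summit.QuantumFields.BalabanUV.Beta.FP.RelInvPeriodisedMinOp (minOp_fromRows_apply_inl minOpL_fromRows_apply_inl flucCov_fromRows_apply)
open Summit.QuantumFields.BalabanUV.Beta.FP.RelInvPeriodisedMinOpRecord (comb_presentation comb_mask_eq_axEc_mul)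
open Summit.QuantumFields.BalabanUV.Beta.FP.RelInvPeriodisedChartMinOp (torus_inv_kkt_of_slots_inl_inr_of_relInv torus_inv_kkt_of_slots_inr_inl_of_relInv
  torus_inv_kkt_of_slots_inl_inl_of_relInv)

/-! ## §3 At the presentation of record, any chart -/

section Record

variable {d : ℕ} {Lc : ℕ} [NeZero Lc] {r : Fin (d + 1) → ℕ} (M : Fin (d + 1) → ℕ) [∀ μ, NeZero (M μ)] {A Mh : MKer (d + 1) (Fib d)}

set_option synthInstance.maxSize 1024 in
/-- **[folklore] THE `μ`-COLUMNS OF THE MINIMISER OF THE COMB-SLICED PERIODISED SYSTEM, ANY CHART** (presentation of record: fields `(s, α) ↦ (s, inl α)`,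
`τ₁ := combRowsT (toSite r) Lc M` on the field slots, coarse multipliers by any injective `inr`-valued `fμ` with `hcoarse`):
`minOp H₀ [Q₁₀;τ₁] (s, α) (inl a) = axEc (toSite r) Lc s s (inl α) (inl α) · Â ((s, inl α)) (fμ a)`,
`Â := perF M A` — `+Â` on the non-comb field slots, `0` on the comb slots. -/
theorem torus_minOp_inl_of_relInv (hr : r ∈ box (d + 1) Lc) (hM : ∀ i, Lc ∣ M i) (hA : Spr A) (hMh : Spr Mh)
    (hAt : ∀ t : Fin (d + 1) → ℤ, shiftK ((Lc : ℤ) • t) A = A) (hMt : ∀ t : Fin (d + 1) → ℤ, shiftK ((Lc : ℤ) • t) Mh = Mh)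
    (hrel : RelInv A Mh (axEc (toSite r) Lc))
    (hmm : ∀ (x y : Fin (d + 1) → ℤ) (κ l : Fin (d + 1)), Mh x y (Sum.inr κ) (Sum.inr l) = 0)
    (hanti : ∀ (x y : Fin (d + 1) → ℤ) (κ l : Fin (d + 1)), Mh x y (Sum.inl κ) (Sum.inr l) = -Mh y x (Sum.inr l) (Sum.inl κ))
    {μ : Type*} [Fintype μ] [DecidableEq μ] (fμ : μ → Idx M (Fib d)) (hfμ : Function.Injective fμ)
    (hμ : ∀ a : μ, ∃ m : Fin (d + 1), (fμ a).2 = Sum.inr m)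
    (hcoarse : ∀ (s : ↥(pbox M)) (m : Fin (d + 1)), ((s, Sum.inr m) : Idx M (Fib d)) ∈ Set.range fμ ↔ Torus.proj Lc (s : Site (d + 1)) = 0)
    (b : ↥(pbox M) × Fin (d + 1)) (a : μ) :
    minOp ((perF M Mh).submatrix (fun b : ↥(pbox M) × Fin (d + 1) => ((b.1, Sum.inl b.2) : Idx M (Fib d)))
          (fun b : ↥(pbox M) × Fin (d + 1) => ((b.1, Sum.inl b.2) : Idx M (Fib d))))
        (fromRows
          ((perF M Mh).submatrix fμ (fun b : ↥(pbox M) × Fin (d + 1) => ((b.1, Sum.inl b.2) : Idx M (Fib d))))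
          ((combRowsT (toSite r) Lc M).submatrix id (fun b : ↥(pbox M) × Fin (d + 1) => ((b.1, Sum.inl b.2) : Idx M (Fib d)))))
        b (Sum.inl a)
      = axEc (toSite r) Lc (b.1 : Site (d + 1)) (b.1 : Site (d + 1)) (Sum.inl b.2) (Sum.inl b.2)
          * perF M A (b.1, Sum.inl b.2) (fμ a) := by
  obtain ⟨cb, hcb, hτ, hlive⟩ := comb_presentation M hr hM fμ hμ hcoarse
  have hfν_inj : Function.Injective (fun b : ↥(pbox M) × Fin (d + 1) => ((b.1, Sum.inl b.2) : Idx M (Fib d))) := by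
    rintro ⟨s, α⟩ ⟨s', α'⟩ h
    simp only [Prod.mk.injEq, Sum.inl.injEq] at h
    exact Prod.ext h.1 h.2
  rw [minOp_fromRows_apply_inl, hτ,
    torus_inv_kkt_of_slots_inl_inr_of_relInv M (toSite r) hM hA hMh hAt hMt hrel hmm hanti _ fμ hfν_inj hfμ (fun b => ⟨b.2, rfl⟩) hμ cb hcb hlive b a]
  exact comb_mask_eq_axEc_mul M hμ hlive b.1 b.2 _

set_option synthInstance.maxSize 1024 in
/-- **[folklore] THE `μ`-ROWS OF THE LEFT COMPANION `minOpL`** (same presentation):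
`minOpL H₀ [Q₁₀;τ₁] (inl a) (s, α) = −(axEc (toSite r) Lc s s (inl α) (inl α) · Â (fμ a) ((s, inl α)))`. -/
theorem torus_minOpL_inl_of_relInv (hr : r ∈ box (d + 1) Lc) (hM : ∀ i, Lc ∣ M i) (hA : Spr A) (hMh : Spr Mh)
    (hAt : ∀ t : Fin (d + 1) → ℤ, shiftK ((Lc : ℤ) • t) A = A) (hMt : ∀ t : Fin (d + 1) → ℤ, shiftK ((Lc : ℤ) • t) Mh = Mh)
    (hrel : RelInv A Mh (axEc (toSite r) Lc))
    (hmm : ∀ (x y : Fin (d + 1) → ℤ) (κ l : Fin (d + 1)), Mh x y (Sum.inr κ) (Sum.inr l) = 0)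
    (hanti : ∀ (x y : Fin (d + 1) → ℤ) (κ l : Fin (d + 1)), Mh x y (Sum.inl κ) (Sum.inr l) = -Mh y x (Sum.inr l) (Sum.inl κ))
    {μ : Type*} [Fintype μ] [DecidableEq μ] (fμ : μ → Idx M (Fib d)) (hfμ : Function.Injective fμ)
    (hμ : ∀ a : μ, ∃ m : Fin (d + 1), (fμ a).2 = Sum.inr m)
    (hcoarse : ∀ (s : ↥(pbox M)) (m : Fin (d + 1)), ((s, Sum.inr m) : Idx M (Fib d)) ∈ Set.range fμ ↔ Torus.proj Lc (s : Site (d + 1)) = 0)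
    (a : μ) (b : ↥(pbox M) × Fin (d + 1)) :
    minOpL ((perF M Mh).submatrix (fun b : ↥(pbox M) × Fin (d + 1) => ((b.1, Sum.inl b.2) : Idx M (Fib d)))
          (fun b : ↥(pbox M) × Fin (d + 1) => ((b.1, Sum.inl b.2) : Idx M (Fib d))))
        (fromRows
          ((perF M Mh).submatrix fμ (fun b : ↥(pbox M) × Fin (d + 1) => ((b.1, Sum.inl b.2) : Idx M (Fib d))))
          ((combRowsT (toSite r) Lc M).submatrix id (fun b : ↥(pbox M) × Fin (d + 1) => ((b.1, Sum.inl b.2) : Idx M (Fib d)))))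
        (Sum.inl a) b
      = -(axEc (toSite r) Lc (b.1 : Site (d + 1)) (b.1 : Site (d + 1)) (Sum.inl b.2) (Sum.inl b.2)
          * perF M A (fμ a) (b.1, Sum.inl b.2)) := by
  obtain ⟨cb, hcb, hτ, hlive⟩ := comb_presentation M hr hM fμ hμ hcoarse
  have hfν_inj : Function.Injective (fun b : ↥(pbox M) × Fin (d + 1) => ((b.1, Sum.inl b.2) : Idx M (Fib d))) := by
    rintro ⟨s, α⟩ ⟨s', α'⟩ h
    simp only [Prod.mk.injEq, Sum.inl.injEq] at h
    exact Prod.ext h.1 h.2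
  rw [minOpL_fromRows_apply_inl, hτ,
    torus_inv_kkt_of_slots_inr_inl_of_relInv M (toSite r) hM hA hMh hAt hMt hrel hmm hanti _ fμ hfν_inj hfμ (fun b => ⟨b.2, rfl⟩) hμ cb hcb hlive a b, ← mul_neg]
  exact comb_mask_eq_axEc_mul M hμ hlive b.1 b.2 _

set_option synthInstance.maxSize 1024 in
/-- **[folklore] MATRIX FORM: the `μ`-COLUMN BLOCK of the minimiser** — `(minOp H₀ [Q₁₀;τ₁]).submatrix id inl = of (fun (s,α) a ↦ axEc s s α α · Â (s, inl α) (fμ a))`. -/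
theorem torus_minOp_submatrix_inl_of_relInv (hr : r ∈ box (d + 1) Lc) (hM : ∀ i, Lc ∣ M i) (hA : Spr A) (hMh : Spr Mh)
    (hAt : ∀ t : Fin (d + 1) → ℤ, shiftK ((Lc : ℤ) • t) A = A) (hMt : ∀ t : Fin (d + 1) → ℤ, shiftK ((Lc : ℤ) • t) Mh = Mh)
    (hrel : RelInv A Mh (axEc (toSite r) Lc))
    (hmm : ∀ (x y : Fin (d + 1) → ℤ) (κ l : Fin (d + 1)), Mh x y (Sum.inr κ) (Sum.inr l) = 0)
    (hanti : ∀ (x y : Fin (d + 1) → ℤ) (κ l : Fin (d + 1)), Mh x y (Sum.inl κ) (Sum.inr l) = -Mh y x (Sum.inr l) (Sum.inl κ))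
    {μ : Type*} [Fintype μ] [DecidableEq μ] (fμ : μ → Idx M (Fib d)) (hfμ : Function.Injective fμ)
    (hμ : ∀ a : μ, ∃ m : Fin (d + 1), (fμ a).2 = Sum.inr m)
    (hcoarse : ∀ (s : ↥(pbox M)) (m : Fin (d + 1)), ((s, Sum.inr m) : Idx M (Fib d)) ∈ Set.range fμ ↔ Torus.proj Lc (s : Site (d + 1)) = 0) :
    (minOp ((perF M Mh).submatrix (fun b : ↥(pbox M) × Fin (d + 1) => ((b.1, Sum.inl b.2) : Idx M (Fib d)))
          (fun b : ↥(pbox M) × Fin (d + 1) => ((b.1, Sum.inl b.2) : Idx M (Fib d))))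
        (fromRows
          ((perF M Mh).submatrix fμ (fun b : ↥(pbox M) × Fin (d + 1) => ((b.1, Sum.inl b.2) : Idx M (Fib d))))
          ((combRowsT (toSite r) Lc M).submatrix id (fun b : ↥(pbox M) × Fin (d + 1) => ((b.1, Sum.inl b.2) : Idx M (Fib d)))))).submatrix
        id Sum.inl
      = Matrix.of fun (b : ↥(pbox M) × Fin (d + 1)) (a : μ) =>
          axEc (toSite r) Lc (b.1 : Site (d + 1)) (b.1 : Site (d + 1)) (Sum.inl b.2) (Sum.inl b.2)
            * perF M A (b.1, Sum.inl b.2) (fμ a) := by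
  ext b a
  rw [submatrix_apply, of_apply, id]
  exact torus_minOp_inl_of_relInv M hr hM hA hMh hAt hMt hrel hmm hanti fμ hfμ hμ hcoarse b a

set_option synthInstance.maxSize 1024 in
/-- **[folklore] MATRIX FORM: the `μ`-ROW BLOCK of the left companion** — `(minOpL H₀ [Q₁₀;τ₁]).submatrix inl id = −of (fun a (s,α) ↦ axEc s s α α · Â (fμ a) (s, inl α))`. -/
theorem torus_minOpL_submatrix_inl_of_relInv (hr : r ∈ box (d + 1) Lc) (hM : ∀ i, Lc ∣ M i) (hA : Spr A) (hMh : Spr Mh)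
    (hAt : ∀ t : Fin (d + 1) → ℤ, shiftK ((Lc : ℤ) • t) A = A) (hMt : ∀ t : Fin (d + 1) → ℤ, shiftK ((Lc : ℤ) • t) Mh = Mh)
    (hrel : RelInv A Mh (axEc (toSite r) Lc))
    (hmm : ∀ (x y : Fin (d + 1) → ℤ) (κ l : Fin (d + 1)), Mh x y (Sum.inr κ) (Sum.inr l) = 0)
    (hanti : ∀ (x y : Fin (d + 1) → ℤ) (κ l : Fin (d + 1)), Mh x y (Sum.inl κ) (Sum.inr l) = -Mh y x (Sum.inr l) (Sum.inl κ))
    {μ : Type*} [Fintype μ] [DecidableEq μ] (fμ : μ → Idx M (Fib d)) (hfμ : Function.Injective fμ)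
    (hμ : ∀ a : μ, ∃ m : Fin (d + 1), (fμ a).2 = Sum.inr m)
    (hcoarse : ∀ (s : ↥(pbox M)) (m : Fin (d + 1)), ((s, Sum.inr m) : Idx M (Fib d)) ∈ Set.range fμ ↔ Torus.proj Lc (s : Site (d + 1)) = 0) :
    (minOpL ((perF M Mh).submatrix (fun b : ↥(pbox M) × Fin (d + 1) => ((b.1, Sum.inl b.2) : Idx M (Fib d)))
          (fun b : ↥(pbox M) × Fin (d + 1) => ((b.1, Sum.inl b.2) : Idx M (Fib d))))
        (fromRows
          ((perF M Mh).submatrix fμ (fun b : ↥(pbox M) × Fin (d + 1) => ((b.1, Sum.inl b.2) : Idx M (Fib d))))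
          ((combRowsT (toSite r) Lc M).submatrix id (fun b : ↥(pbox M) × Fin (d + 1) => ((b.1, Sum.inl b.2) : Idx M (Fib d)))))).submatrix
        Sum.inl id
      = -Matrix.of fun (a : μ) (b : ↥(pbox M) × Fin (d + 1)) =>
          axEc (toSite r) Lc (b.1 : Site (d + 1)) (b.1 : Site (d + 1)) (Sum.inl b.2) (Sum.inl b.2)
            * perF M A (fμ a) (b.1, Sum.inl b.2) := by
  ext a b
  rw [submatrix_apply, neg_apply, of_apply, id]
  exact torus_minOpL_inl_of_relInv M hr hM hA hMh hAt hMt hrel hmm hanti fμ hfμ hμ hcoarse a b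

set_option synthInstance.maxSize 1024 in
/-- **[folklore] THE FLUCTUATION COVARIANCE OF THE COMB-SLICED PERIODISED LEVEL-`j` SYSTEM, ENTRYWISE** (same presentation):
`flucCov H₀ [Q₁₀;τ₁] (s,α) (s',α') = axEc s s (inl α) (inl α) · axEc s' s' (inl α') (inl α') · Â (s, inl α) (s', inl α')` — `+Â` between non-comb field slots,
`0` as soon as one slot is on the comb. -/
theorem torus_flucCov_apply_of_relInv (hr : r ∈ box (d + 1) Lc) (hM : ∀ i, Lc ∣ M i) (hA : Spr A) (hMh : Spr Mh)
    (hAt : ∀ t : Fin (d + 1) → ℤ, shiftK ((Lc : ℤ) • t) A = A) (hMt : ∀ t : Fin (d + 1) → ℤ, shiftK ((Lc : ℤ) • t) Mh = Mh)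
    (hrel : RelInv A Mh (axEc (toSite r) Lc))
    (hmm : ∀ (x y : Fin (d + 1) → ℤ) (κ l : Fin (d + 1)), Mh x y (Sum.inr κ) (Sum.inr l) = 0)
    (hanti : ∀ (x y : Fin (d + 1) → ℤ) (κ l : Fin (d + 1)), Mh x y (Sum.inl κ) (Sum.inr l) = -Mh y x (Sum.inr l) (Sum.inl κ))
    {μ : Type*} [Fintype μ] [DecidableEq μ] (fμ : μ → Idx M (Fib d)) (hfμ : Function.Injective fμ)
    (hμ : ∀ a : μ, ∃ m : Fin (d + 1), (fμ a).2 = Sum.inr m)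
    (hcoarse : ∀ (s : ↥(pbox M)) (m : Fin (d + 1)), ((s, Sum.inr m) : Idx M (Fib d)) ∈ Set.range fμ ↔ Torus.proj Lc (s : Site (d + 1)) = 0)
    (b b' : ↥(pbox M) × Fin (d + 1)) :
    flucCov ((perF M Mh).submatrix (fun b : ↥(pbox M) × Fin (d + 1) => ((b.1, Sum.inl b.2) : Idx M (Fib d)))
          (fun b : ↥(pbox M) × Fin (d + 1) => ((b.1, Sum.inl b.2) : Idx M (Fib d))))
        (fromRows
          ((perF M Mh).submatrix fμ (fun b : ↥(pbox M) × Fin (d + 1) => ((b.1, Sum.inl b.2) : Idx M (Fib d))))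
          ((combRowsT (toSite r) Lc M).submatrix id (fun b : ↥(pbox M) × Fin (d + 1) => ((b.1, Sum.inl b.2) : Idx M (Fib d)))))
        b b'
      = axEc (toSite r) Lc (b.1 : Site (d + 1)) (b.1 : Site (d + 1)) (Sum.inl b.2) (Sum.inl b.2)
          * (axEc (toSite r) Lc (b'.1 : Site (d + 1)) (b'.1 : Site (d + 1)) (Sum.inl b'.2) (Sum.inl b'.2)
            * perF M A (b.1, Sum.inl b.2) (b'.1, Sum.inl b'.2)) := by
  classical
  obtain ⟨cb, hcb, hτ, hlive⟩ := comb_presentation M hr hM fμ hμ hcoarse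
  have hfν_inj : Function.Injective (fun b : ↥(pbox M) × Fin (d + 1) => ((b.1, Sum.inl b.2) : Idx M (Fib d))) := by
    rintro ⟨s, α⟩ ⟨s', α'⟩ h
    simp only [Prod.mk.injEq, Sum.inl.injEq] at h
    exact Prod.ext h.1 h.2
  rw [flucCov_fromRows_apply, hτ,
    torus_inv_kkt_of_slots_inl_inl_of_relInv M (toSite r) hM hA hMh hAt hMt hrel hmm hanti _ fμ hfν_inj hfμ (fun b => ⟨b.2, rfl⟩) hμ cb hcb hlive b b',
    ← comb_mask_eq_axEc_mul M hμ hlive b'.1 b'.2, ← comb_mask_eq_axEc_mul M hμ hlive b.1 b.2]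
  by_cases h : b ∈ Set.range cb
  · rw [if_pos (Or.inl h), if_pos h]
  · rw [if_neg h]
    by_cases h' : b' ∈ Set.range cb
    · rw [if_pos (Or.inr h'), if_pos h']
    · rw [if_neg (not_or.2 ⟨h, h'⟩), if_neg h']

set_option synthInstance.maxSize 1024 in
/-- **[folklore] MATRIX FORM: the FLUCTUATION COVARIANCE** — `flucCov H₀ [Q₁₀;τ₁] = of (fun (s,α) (s',α') ↦ axEc s s α α · (axEc s' s' α' α' · Â (s, inl α) (s', inl α')))`. -/
theorem torus_flucCov_eq_of_relInv (hr : r ∈ box (d + 1) Lc) (hM : ∀ i, Lc ∣ M i) (hA : Spr A) (hMh : Spr Mh)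
    (hAt : ∀ t : Fin (d + 1) → ℤ, shiftK ((Lc : ℤ) • t) A = A) (hMt : ∀ t : Fin (d + 1) → ℤ, shiftK ((Lc : ℤ) • t) Mh = Mh)
    (hrel : RelInv A Mh (axEc (toSite r) Lc))
    (hmm : ∀ (x y : Fin (d + 1) → ℤ) (κ l : Fin (d + 1)), Mh x y (Sum.inr κ) (Sum.inr l) = 0)
    (hanti : ∀ (x y : Fin (d + 1) → ℤ) (κ l : Fin (d + 1)), Mh x y (Sum.inl κ) (Sum.inr l) = -Mh y x (Sum.inr l) (Sum.inl κ))
    {μ : Type*} [Fintype μ] [DecidableEq μ] (fμ : μ → Idx M (Fib d)) (hfμ : Function.Injective fμ)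
    (hμ : ∀ a : μ, ∃ m : Fin (d + 1), (fμ a).2 = Sum.inr m)
    (hcoarse : ∀ (s : ↥(pbox M)) (m : Fin (d + 1)), ((s, Sum.inr m) : Idx M (Fib d)) ∈ Set.range fμ ↔ Torus.proj Lc (s : Site (d + 1)) = 0) :
    flucCov ((perF M Mh).submatrix (fun b : ↥(pbox M) × Fin (d + 1) => ((b.1, Sum.inl b.2) : Idx M (Fib d)))
          (fun b : ↥(pbox M) × Fin (d + 1) => ((b.1, Sum.inl b.2) : Idx M (Fib d))))
        (fromRows
          ((perF M Mh).submatrix fμ (fun b : ↥(pbox M) × Fin (d + 1) => ((b.1, Sum.inl b.2) : Idx M (Fib d))))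
          ((combRowsT (toSite r) Lc M).submatrix id (fun b : ↥(pbox M) × Fin (d + 1) => ((b.1, Sum.inl b.2) : Idx M (Fib d)))))
      = Matrix.of fun (b b' : ↥(pbox M) × Fin (d + 1)) =>
          axEc (toSite r) Lc (b.1 : Site (d + 1)) (b.1 : Site (d + 1)) (Sum.inl b.2) (Sum.inl b.2)
            * (axEc (toSite r) Lc (b'.1 : Site (d + 1)) (b'.1 : Site (d + 1)) (Sum.inl b'.2) (Sum.inl b'.2)
              * perF M A (b.1, Sum.inl b.2) (b'.1, Sum.inl b'.2)) := by
  ext b b'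
  rw [of_apply]
  exact torus_flucCov_apply_of_relInv M hr hM hA hMh hAt hMt hrel hmm hanti fμ hfμ hμ hcoarse b b'

end Record

end Summit.QuantumFields.BalabanUV.Beta.FP.RelInvPeriodisedChartMinOpRecord

end
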